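import Summits.BirchSwinnertonDyer.BirchSwinnertonDyer.Theses.ErratumRoadFive
import Summits.BirchSwinnertonDyer.BirchSwinnertonDyer.Theorems.ErratumRoadFiveNonSurjCornerKolyJTamZero
import Literature.NumberTheory.EllipticCurves.LangHeightNonarchEstimate

/-!
# BC3 skeleton v2 (RESHAPE) — crux child `NonSurjCornerKolyJ` of `ErratumRoadFive.NonSurjCorner`
# (item stmt-BirchSwinnertonDyer-19947; parent 19065, K2 rev 22), line `Lines/birth.lean`

Reshape by corner-p1 g7 (2026-08-27) of the registered v1 (planner g30, c955a09bc2b812f6: one open stub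
`stub_kolyJ_tamPos` = the whole Jetchev direction in SUM form on `p ∣ ∏c`). The `t ≥ 1` content is cut BY
CARRIER PROFILE, which is where print and kernel distance actually differ (memo HOME/corner/g7/CORNER-G7.md §1–§2):

* `stub_kolyJ_max` — **Jetchev's Theorem 1.4 in MAX form, read at `p ∥ N` on corner frames, EVERY carrier `v`
  INCLUDING `v = p`**: for every finite place `v` of `ℚ` and every depth `s ≤ ord_p c_v(E/ℚ)`, every derived
  Heegner point `P_n` at a Kolyvagin level of index `≥ s` is `p^s`-divisible (`PDiv d p s`). This is EXACTLY the
  shape of the registered `stub_jetchevMaxHLAtThree` of item 19109 (tam3, `…EulerHalvesAtThreeKolyvaginRedefinition`)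
  with `3 ↦ p ∈ {5,7}` and `Surj ↦ ¬Surj ∧ (irr)`; kernel distance = the instantiation layer of the abstract §6
  kernel `JET.Section6.tamagawaExponent_le_m_of_selmerFamilies` (p484791, `p`-generic, carrier-blind) + the (irr)
  re-key of Lemma 6.1 (Jetchev Rem. 6.2) + Prop. 4.9 AT `v ∣ p` for split multiplicative `p` (g7's component-group
  argument replacing Lemma 4.3, CORNER-G7 §1). Covers every single-carrier corner pair: 37 of the 40 `t ≥ 1`
  pairs at `p = 5`, `N < 5·10⁵` (32 split-at-5 pairs carried by `c_5` alone, 5 non-split pairs carried by one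
  `q ≠ 5`).
* `stub_kolyJ_multi` — the SUM form on MULTI-carrier pairs (no single `c_v` absorbs `ord_p ∏c`): the additivity
  across carriers that no max-form argument gives (Burungale–Castella–Grossi–Skinner Thm. 2 shape, IMC-grade;
  3 of 40 pairs at `p = 5`: 84960d1, 296240ce1, 304560by1, all `t = 2 = 1 + 1`).
* `stub_kolyJ_tamZero` (t = 0) stays CLOSED (p490656) and is discharged inside the composition.

`NonSurjCornerKolyJ_of (hmax) (hmulti)` is pure logic: case split on `p ∣ ∏c`, then on
`∃ v, ord_p ∏c ≤ ord_p c_v`. Sorries live only in the two open `stub_*`. Nothing is asserted about any curve;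
this file proves the crux child only modulo its stubs (T7).
-/

set_option linter.dupNamespace false
set_option autoImplicit false

namespace Summit.BirchSwinnertonDyer.BirchSwinnertonDyer.Cruxes.NonSurjCornerKolyJ.Birth

open Literature.NumberTheory.EllipticCurves Literature.NumberTheory.EllipticCurves.ModularForms
  Literature.NumberTheory.EllipticCurves.Rank1Residual Summit.BirchSwinnertonDyer.Rank1Residual
  Summit.BirchSwinnertonDyer.Rank1Residual.X11b.Three.Koly IsDedekindDomain NumberField

/-- **stub (t = 0), CLOSED**: the branch at pairs with `p ∤ ∏_ℓ c_ℓ(E/ℚ)` — served by the landed theorem (p490656). -/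
theorem stub_kolyJ_tamZero :
    ∀ (W : WeierstrassCurve ℚ) [W.IsElliptic] [W.IsGloballyMinimal] [NeZero (W.conductorNorm ℤ)]
      (p : ℕ) [Fact p.Prime] (K : Type) [Field K] [NumberField K]
      (Dt : ModularParametrizationData W (W.conductorNorm ℤ)) (β : ℤ) (ι : K →+* ℂ),
      ¬ p ∣ W.tamagawaProduct →
      ClassX11b W p → ¬ Surj W p → (p = 5 ∨ p = 7) → p ∣ padicValInt p W.minimalDiscriminantInt →
      ¬ Ram W p → IsImaginaryQuadratic K → 4 < (NumberField.discr K).natAbs →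
      SatisfiesHeegnerHypothesis (W.conductorNorm ℤ) K → SatisfiesHeegnerHypothesis p K →
      (4 * (W.conductorNorm ℤ : ℤ)) ∣ β ^ 2 - NumberField.discr K → ¬ (p : ℤ) ∣ Dt.c →
      ∀ (s : ℕ), s ≤ padicValNat p W.tamagawaProduct →
        ∀ (n : ℕ) (d : KolyvaginHeegnerData Dt β ι n), Squarefree n →
          (∀ ℓ ∈ n.primeFactors, Zhang2014.IsKolyvaginPrime (W.conductorNorm ℤ) W K p ℓ ∧
            s ≤ Zhang2014.kolyvaginIndex W p ℓ) → PDiv d p s :=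
  Summit.BirchSwinnertonDyer.BirchSwinnertonDyer.Theorems.nonSurjCornerKolyJ_of_not_dvd_tamagawa

/-- **stub (max form), OPEN** — Jetchev 2008 Thm. 1.4 read at `p ∥ N` on corner frames, for EVERY carrier place
`v` of `ℚ` (including `v = p`): `P_n ∈ p^s E(K[n])` for all `s ≤ ord_p c_v(E/ℚ)` at Kolyvagin levels of index `≥ s`.
[shape: Jetchev2008 Thm. 1.4 (arXiv p. 3), proved there only for `p ∤ N`, `ρ̄` onto] -/
theorem stub_kolyJ_max :
    ∀ (W : WeierstrassCurve ℚ) [W.IsElliptic] [W.IsGloballyMinimal] [NeZero (W.conductorNorm ℤ)]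
      (p : ℕ) [Fact p.Prime] (K : Type) [Field K] [NumberField K]
      (Dt : ModularParametrizationData W (W.conductorNorm ℤ)) (β : ℤ) (ι : K →+* ℂ),
      p ∣ W.tamagawaProduct →
      ClassX11b W p → ¬ Surj W p → (p = 5 ∨ p = 7) → p ∣ padicValInt p W.minimalDiscriminantInt →
      ¬ Ram W p → IsImaginaryQuadratic K → 4 < (NumberField.discr K).natAbs →
      SatisfiesHeegnerHypothesis (W.conductorNorm ℤ) K → SatisfiesHeegnerHypothesis p K →
      (4 * (W.conductorNorm ℤ : ℤ)) ∣ β ^ 2 - NumberField.discr K → ¬ (p : ℤ) ∣ Dt.c →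
      ∀ (v : HeightOneSpectrum (𝓞 ℚ)) (s : ℕ), s ≤ padicValNat p (W.tamagawaNumberAt v) →
        ∀ (n : ℕ) (d : KolyvaginHeegnerData Dt β ι n), Squarefree n →
          (∀ ℓ ∈ n.primeFactors, Zhang2014.IsKolyvaginPrime (W.conductorNorm ℤ) W K p ℓ ∧
            s ≤ Zhang2014.kolyvaginIndex W p ℓ) → PDiv d p s := by
  sorry

/-- **stub (sum form on MULTI-carrier pairs), OPEN** — the Jetchev direction to the full depth
`t = ord_p ∏_ℓ c_ℓ(E/ℚ)` at pairs where NO single place carries the whole `p`-part of `∏c`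
(`ord_p c_v < t` for every `v`): the additivity across carriers. [shape: BCGS arXiv:2312.09301 Thm. 2
(`𝓜_∞ = Σ_ℓ ord_p c_ℓ`), printed only at good ordinary `p > 3` via the rational anticyclotomic main conjecture] -/
theorem stub_kolyJ_multi :
    ∀ (W : WeierstrassCurve ℚ) [W.IsElliptic] [W.IsGloballyMinimal] [NeZero (W.conductorNorm ℤ)]
      (p : ℕ) [Fact p.Prime] (K : Type) [Field K] [NumberField K]
      (Dt : ModularParametrizationData W (W.conductorNorm ℤ)) (β : ℤ) (ι : K →+* ℂ),
      p ∣ W.tamagawaProduct →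
      (∀ v : HeightOneSpectrum (𝓞 ℚ), padicValNat p (W.tamagawaNumberAt v) < padicValNat p W.tamagawaProduct) →
      ClassX11b W p → ¬ Surj W p → (p = 5 ∨ p = 7) → p ∣ padicValInt p W.minimalDiscriminantInt →
      ¬ Ram W p → IsImaginaryQuadratic K → 4 < (NumberField.discr K).natAbs →
      SatisfiesHeegnerHypothesis (W.conductorNorm ℤ) K → SatisfiesHeegnerHypothesis p K →
      (4 * (W.conductorNorm ℤ : ℤ)) ∣ β ^ 2 - NumberField.discr K → ¬ (p : ℤ) ∣ Dt.c →
      ∀ (s : ℕ), s ≤ padicValNat p W.tamagawaProduct →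
        ∀ (n : ℕ) (d : KolyvaginHeegnerData Dt β ι n), Squarefree n →
          (∀ ℓ ∈ n.primeFactors, Zhang2014.IsKolyvaginPrime (W.conductorNorm ℤ) W K p ℓ ∧
            s ≤ Zhang2014.kolyvaginIndex W p ℓ) → PDiv d p s := by
  sorry

/-! ## Stub statements by name -/

namespace Statement

/-- Statement of `stub_kolyJ_tamZero`. -/
abbrev stub_kolyJ_tamZero : Prop := type_of% @Birth.stub_kolyJ_tamZero
/-- Statement of `stub_kolyJ_max`. -/
abbrev stub_kolyJ_max : Prop := type_of% @Birth.stub_kolyJ_max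
/-- Statement of `stub_kolyJ_multi`. -/
abbrev stub_kolyJ_multi : Prop := type_of% @Birth.stub_kolyJ_multi

end Statement

/-! ## The composition (sorry-free): the stub STATEMENTS imply the crux child, BY NAME (route decl) -/

/-- **`NonSurjCornerKolyJ_of`** — pure logic, concluding the ROUTE decl: case split on `p ∣ ∏c` (the CLOSED t = 0
stub is discharged inside, landed p490656), then on whether ONE place `v` carries the whole `p`-part of `∏c`
(`ord_p ∏c ≤ ord_p c_v`: the max form at `v` reaches depth `t`) or none does (the multi-carrier stub). -/
theorem NonSurjCornerKolyJ_of (hmax : Statement.stub_kolyJ_max) (hmulti : Statement.stub_kolyJ_multi) :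
    Summit.BirchSwinnertonDyer.BirchSwinnertonDyer.Theses.ErratumRoadFive.NonSurjCornerKolyJ := by
  show Summit.BirchSwinnertonDyer.BirchSwinnertonDyer.Theorems.NonSurjCornerKolyJ
  intro W _ _ _ p _ K _ _ Dt β ι hX hns h57 hv hnr hK hd hHN hHp hβ hc s hs n d hn hℓ
  by_cases htam : p ∣ W.tamagawaProduct
  · by_cases hmono : ∃ v : HeightOneSpectrum (𝓞 ℚ),
        padicValNat p W.tamagawaProduct ≤ padicValNat p (W.tamagawaNumberAt v)
    · obtain ⟨v, hvt⟩ := hmono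
      exact hmax W p K Dt β ι htam hX hns h57 hv hnr hK hd hHN hHp hβ hc v s (hs.trans hvt) n d hn hℓ
    · push Not at hmono
      exact hmulti W p K Dt β ι htam hmono hX hns h57 hv hnr hK hd hHN hHp hβ hc s hs n d hn hℓ
  · exact stub_kolyJ_tamZero W p K Dt β ι htam hX hns h57 hv hnr hK hd hHN hHp hβ hc s hs n d hn hℓ

/-- The crux child along this line, MODULO exactly the registered stubs (sorries only in open `stub_*`). -/
theorem NonSurjCornerKolyJ_proof :
    Summit.BirchSwinnertonDyer.BirchSwinnertonDyer.Theses.ErratumRoadFive.NonSurjCornerKolyJ :=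
  NonSurjCornerKolyJ_of stub_kolyJ_max stub_kolyJ_multi

end Summit.BirchSwinnertonDyer.BirchSwinnertonDyer.Cruxes.NonSurjCornerKolyJ.Birth
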